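import Summits.HodgeConjecture.HodgeConjecture.Theorems.VHCAbelianSchemesRoadDegreeConfinementItems
import HarnessLib

/-!
# BC3 birth skeleton v4 (BY ROUTE NAME; stub 1 DISCHARGED; stub 2 CONFINED TO THE MIDDLE RANGE) — twin crux `SemiregularSheafRepresentativesTwAt`
# (K-SR♭∃ over the TWISTED door `Literature.AlgebraicGeometry.HodgeTheory.twistedReflexiveClass`), ring2 LEAD gen 146 / ab-andre-2 gen 54

research route conditional on HC_CM; not a corollary; Q11.4-sentence-2 already refuted in dim ≥ 3.

REGIME SPLIT (structure vs. exceptional) as in v2/v3, now GRADED BY DEGREE: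
* `stub_lefschetzRegimeTw` — `W` algebraic-Lefschetz on EVERY fibre: the null datum. PROVED (ab-andre-2 gen 53, p434003, gate `landed`).
* `stub_exceptionalRegimeTw_midRange` — `W` exceptional on some fibre, AT relative dimension `n` and codimension `p` with `2 ≤ p ≤ n − 2`
  ONLY: the research content (XL) — a semiregular TWISTED carrier with `κ_p = a·W| + (Lefschetz)` at some fibre. The degrees
  `p ≤ 1` and `p ≥ n − 1` (in particular every pencil of relative dimension `≤ 3`) are DISCHARGED by the degree confinement
  (`Theorems/VHCAbelianSchemesRoadDegreeConfinement.lean`, p442807: there the regime hypothesis is contradictory, FACT-FREE — Lefschetz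
  `(1,1)`, hard Lefschetz, `H⁰ = ℂ·1` on the smooth projective fibres); v2/v3's ungraded `stub_exceptionalRegimeTw` is EQUIVALENT to this stub
  (`lefAtExceptionalRegime_iff_midRange`). FIRST PAIR `(n, p) = (4, 2)` (Weil-type abelian fourfold pencils).
* `stub_rung_sixfoldMiddleTw` — BC5 PLAN-ONLY separating rung = the graded regime AT `(6, 3)` (`LefAtExceptionalRegimeSixfoldMiddle 𝒪 ↔
  LefAtExceptionalRegimeAt 𝒪 6 3`, `Iff.rfl`): a literal instance of stub 2 (`rung_of_exceptionalRegimeTw_midRange`), not used by `_of`.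
`SemiregularSheafRepresentativesTwAt_of` concludes the ROUTE ITEM BY NAME
(`Summit.HodgeConjecture.HodgeConjecture.Theses.VHCAbelianSchemesRoad.SemiregularSheafRepresentativesTwAt`, rev 12 of the route file) from stub 2
alone (`semiregularSheafRepresentativesTwAt_of_midRange`, p443066; stub 1 being a theorem); sorries ONLY inside `stub_*` (2 = stub 2 load-bearing
+ the plan-only rung). All regime predicates are the LANDED constants of `Theorems/VHCAbelianSchemesRoadRegimeDefs.lean` (§1 p433748, §2 p441761).
-/

noncomputable section

open CategoryTheory CategoryTheory.Limits AlgebraicGeometry Topology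
open Literature.AlgebraicGeometry Literature.AlgebraicGeometry.Motives
open Literature.AlgebraicGeometry.HodgeTheory
open Literature.AlgebraicTopology.SingularHomology
open Literature.Barriers.HodgeConjecture (divisorClassesSpan)
open Summit.Ventures.HSemireg (ObjClass bfSheafClass)
open Summit.HodgeConjecture.HodgeConjecture.Ring2.SemiregularRepresentatives (AdmissibleRepresentativesLefAt
  LefAtLefschetzRegime LefAtExceptionalRegime LefAtExceptionalRegimeAt LefAtExceptionalRegimeSixfoldMiddle
  lefAtExceptionalRegime_iff_midRange semiregularSheafRepresentativesTwAt_of_midRange semiregularSheafRepresentativesTwAt_iff_midRange)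

namespace Summit.HodgeConjecture.HodgeConjecture.Cruxes.SemiregularSheafRepresentativesTwAt.BirthTw

set_option linter.dupNamespace false
set_option linter.unusedVariables false

/-- the twin crux, verbatim the item statement (the route decl `Summit.HodgeConjecture.HodgeConjecture.Theses.VHCAbelianSchemesRoad.SemiregularSheafRepresentativesTwAt` unfolds to it). -/
def TwAt : Prop := ∀ C : Literature.AlgebraicGeometry.HodgeTheory.ChernCharacterBetti, Summit.HodgeConjecture.HodgeConjecture.Ring2.SemiregularRepresentatives.AdmissibleRepresentativesLefAt (Literature.AlgebraicGeometry.HodgeTheory.twistedReflexiveClass C (fun n X₀ I E => Summit.Ventures.HSemireg.gluableSigmaAdmissible n X₀ I E ∨ Literature.AlgebraicGeometry.HodgeTheory.bfSingleAdmissible n X₀ I E))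

/-- STUB 1 (size S): the Lefschetz regime for the twisted door — the null datum. PROVED (p434003). -/
theorem stub_lefschetzRegimeTw : ∀ C : ChernCharacterBetti, LefAtLefschetzRegime (Literature.AlgebraicGeometry.HodgeTheory.twistedReflexiveClass C (fun n X₀ I E => Summit.Ventures.HSemireg.gluableSigmaAdmissible n X₀ I E ∨ Literature.AlgebraicGeometry.HodgeTheory.bfSingleAdmissible n X₀ I E)) :=
  -- DISCHARGED (ab-andre-2 gen 53, p434003): the null datum of the twisted door
  Summit.HodgeConjecture.HodgeConjecture.Theorems.SemiregularSheafRepresentativesTwAt.stub_lefschetzRegimeTw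

/-- STUB 2 (size XL, research), MIDDLE RANGE: the exceptional regime for the twisted door AT `(n, p)`, `2 ≤ p ≤ n − 2` — a semiregular
twisted carrier with `κ_p = a·W| + (Lefschetz)` at some fibre of a pencil of abelian `n`-folds on which the codimension-`p` class `W` is
somewhere exceptional. (Off this range the statement is a THEOREM: `lefAtExceptionalRegimeAt_of_offMidRange`, p442807.) -/
theorem stub_exceptionalRegimeTw_midRange : ∀ (C : ChernCharacterBetti) (n p : ℕ), 2 ≤ p → p + 2 ≤ n →
    LefAtExceptionalRegimeAt (Literature.AlgebraicGeometry.HodgeTheory.twistedReflexiveClass C (fun n X₀ I E => Summit.Ventures.HSemireg.gluableSigmaAdmissible n X₀ I E ∨ Literature.AlgebraicGeometry.HodgeTheory.bfSingleAdmissible n X₀ I E)) n p := by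
  sorry

/-- STUB 3 = BC5 PLAN-ONLY RUNG (size L–XL): the exceptional regime for sixfold pencils, `p = 3`, twisted door — the graded regime at
`(6, 3)` (split-Weil sub-case citation-expected, NON-SPLIT sub-case open = the separating content). -/
theorem stub_rung_sixfoldMiddleTw : ∀ C : ChernCharacterBetti, LefAtExceptionalRegimeSixfoldMiddle (Literature.AlgebraicGeometry.HodgeTheory.twistedReflexiveClass C (fun n X₀ I E => Summit.Ventures.HSemireg.gluableSigmaAdmissible n X₀ I E ∨ Literature.AlgebraicGeometry.HodgeTheory.bfSingleAdmissible n X₀ I E)) := by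
  sorry

/-- The rung is a literal instance of stub 2 (`(n, p) = (6, 3)` lies in the middle range; the rung predicate IS the graded regime at
`(6, 3)` by `Iff.rfl`). -/
theorem rung_of_exceptionalRegimeTw_midRange
    (h : ∀ (C : ChernCharacterBetti) (n p : ℕ), 2 ≤ p → p + 2 ≤ n →
      LefAtExceptionalRegimeAt (Literature.AlgebraicGeometry.HodgeTheory.twistedReflexiveClass C (fun n X₀ I E => Summit.Ventures.HSemireg.gluableSigmaAdmissible n X₀ I E ∨ Literature.AlgebraicGeometry.HodgeTheory.bfSingleAdmissible n X₀ I E)) n p) :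
    ∀ C : ChernCharacterBetti, LefAtExceptionalRegimeSixfoldMiddle (Literature.AlgebraicGeometry.HodgeTheory.twistedReflexiveClass C (fun n X₀ I E => Summit.Ventures.HSemireg.gluableSigmaAdmissible n X₀ I E ∨ Literature.AlgebraicGeometry.HodgeTheory.bfSingleAdmissible n X₀ I E)) :=
  fun C => h C 6 3 (by norm_num) (by norm_num)

/-- v2/v3's ungraded stub 2 is EQUIVALENT to the middle-range stub (degree confinement, p442807). -/
theorem exceptionalRegimeTw_iff_midRange (C : ChernCharacterBetti) :
    LefAtExceptionalRegime (Literature.AlgebraicGeometry.HodgeTheory.twistedReflexiveClass C (fun n X₀ I E => Summit.Ventures.HSemireg.gluableSigmaAdmissible n X₀ I E ∨ Literature.AlgebraicGeometry.HodgeTheory.bfSingleAdmissible n X₀ I E)) ↔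
      ∀ (n p : ℕ), 2 ≤ p → p + 2 ≤ n →
        LefAtExceptionalRegimeAt (Literature.AlgebraicGeometry.HodgeTheory.twistedReflexiveClass C (fun n X₀ I E => Summit.Ventures.HSemireg.gluableSigmaAdmissible n X₀ I E ∨ Literature.AlgebraicGeometry.HodgeTheory.bfSingleAdmissible n X₀ I E)) n p :=
  lefAtExceptionalRegime_iff_midRange

/-- **BC3 composition** — stub 2 (middle range) concludes the ROUTE crux decl BY NAME (stub 1 is a theorem and is consumed inside
`semiregularSheafRepresentativesTwAt_of_midRange`, p443066). -/
theorem SemiregularSheafRepresentativesTwAt_of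
    (h₂ : ∀ (C : ChernCharacterBetti) (n p : ℕ), 2 ≤ p → p + 2 ≤ n →
      LefAtExceptionalRegimeAt (Literature.AlgebraicGeometry.HodgeTheory.twistedReflexiveClass C (fun n X₀ I E => Summit.Ventures.HSemireg.gluableSigmaAdmissible n X₀ I E ∨ Literature.AlgebraicGeometry.HodgeTheory.bfSingleAdmissible n X₀ I E)) n p) :
    Summit.HodgeConjecture.HodgeConjecture.Theses.VHCAbelianSchemesRoad.SemiregularSheafRepresentativesTwAt :=
  semiregularSheafRepresentativesTwAt_of_midRange h₂

/-- The same composition concluding the verbatim statement `TwAt`. -/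
theorem twAt_of
    (h₂ : ∀ (C : ChernCharacterBetti) (n p : ℕ), 2 ≤ p → p + 2 ≤ n →
      LefAtExceptionalRegimeAt (Literature.AlgebraicGeometry.HodgeTheory.twistedReflexiveClass C (fun n X₀ I E => Summit.Ventures.HSemireg.gluableSigmaAdmissible n X₀ I E ∨ Literature.AlgebraicGeometry.HodgeTheory.bfSingleAdmissible n X₀ I E)) n p) : TwAt :=
  show Summit.HodgeConjecture.HodgeConjecture.Theses.VHCAbelianSchemesRoad.SemiregularSheafRepresentativesTwAt from
    SemiregularSheafRepresentativesTwAt_of h₂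

/-- The route crux item is the verbatim statement `TwAt` (by `rfl`). -/
theorem route_item_iff_twAt :
    Summit.HodgeConjecture.HodgeConjecture.Theses.VHCAbelianSchemesRoad.SemiregularSheafRepresentativesTwAt ↔ TwAt := Iff.rfl

/-- Conversely the route crux gives stub 2 back (no slack in the reshaping). -/
theorem midRange_of_route_item (h : Summit.HodgeConjecture.HodgeConjecture.Theses.VHCAbelianSchemesRoad.SemiregularSheafRepresentativesTwAt) :
    ∀ (C : ChernCharacterBetti) (n p : ℕ), 2 ≤ p → p + 2 ≤ n →
      LefAtExceptionalRegimeAt (Literature.AlgebraicGeometry.HodgeTheory.twistedReflexiveClass C (fun n X₀ I E => Summit.Ventures.HSemireg.gluableSigmaAdmissible n X₀ I E ∨ Literature.AlgebraicGeometry.HodgeTheory.bfSingleAdmissible n X₀ I E)) n p :=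
  semiregularSheafRepresentativesTwAt_iff_midRange.1 h

/-- The route crux from the registered stubs (sanity: NOT a proof of the item — sorryAx via stub 2, as designed). -/
theorem semiregularSheafRepresentativesTwAt_of_stubs :
    Summit.HodgeConjecture.HodgeConjecture.Theses.VHCAbelianSchemesRoad.SemiregularSheafRepresentativesTwAt :=
  SemiregularSheafRepresentativesTwAt_of stub_exceptionalRegimeTw_midRange

end Summit.HodgeConjecture.HodgeConjecture.Cruxes.SemiregularSheafRepresentativesTwAt.BirthTw

end
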